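import Literature.AlgebraicGeometry.Resolution.ArithmeticalThreefoldsBlowupFormProofs
import Literature.AlgebraicGeometry.Resolution.CommonAdmissibleBlowup
import Literature.AlgebraicGeometry.Resolution.RegularCentreBlowupSeqIntegral
import Literature.AlgebraicGeometry.Resolution.BlowupsComposition
import Literature.AlgebraicGeometry.Resolution.BlowupsExistence
import Literature.AlgebraicGeometry.Resolution.BlowupsLocal
import Literature.AlgebraicGeometry.Resolution.AffineBlowupUniversal
import Literature.AlgebraicGeometry.Resolution.AffineBlowupUnique
import Literature.AlgebraicGeometry.Resolution.AlterationsDimension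
import HarnessLib

/-!
# Cossart–Piltant's affine threefold resolution as one blowing up — the threefold case from
# Thm. 1.1 as printed, Raynaud–Gruson flattening and Cossart–Piltant's principalization

Topic: `Literature/AlgebraicGeometry/Resolution`. Theorem-only file (sorry-free, no definitions,
no named facts), second companion of the named fact `CossartPiltant2019AffineOneBlowup`
(`ArithmeticalThreefoldsBlowupForm.lean`: for an integral affine `Spec A` of finite type over a
field with `dim A ≤ 3`, a non-zero ideal `J` with `Bl_J(Spec A)` regular and `Bl_J → Spec A` an
isomorphism over `Reg (Spec A)`). The first companion (`ArithmeticalThreefoldsBlowupFormProofs.lean`)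
reduces that fact to the PROJECTIVITY clause of Cossart–Piltant 2019, Thm. 1.1 for affine
schemes, which no named fact of the tree carries. This file PROVES the case `dim A = 3` — the
case consumed downstream (`Summits/ResolutionOfSingularities/…/SectionAscentFibrewiseClosedPointsTraceIdealDimThree.lean`)
— from three EXISTING named facts of the tree, re-running Cossart–Piltant's own Step 3 of the
proof of Prop. 4.6 [arXiv v1: Prop. 4.4] ("achieving (i) in theorem 1.1 with `π` projective for
`𝒳 = Spec A` affine", v1 p. 51) on top of the conclusion of Thm. 1.1 instead of (LU):

1. `CossartPiltant2019General` (`QuasiExcellentSchemes.lean`; CP 2019 Thm. 1.1 (i)(ii) as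
   printed: a PROPER resolution `π : X' → X` which is an isomorphism over `U = Reg X`);
2. `Stacks081R` (`StrictTransformFlattening.lean`; Raynaud–Gruson 1971, I 5.2.2: flattening by
   one `U`-admissible blowing up), through its consequence Stacks 081T PROVED in the tree
   (`exists_isBlowup_dominating_of_stacks081R`, `CommonAdmissibleBlowup.lean`): the proper
   `π`, an isomorphism over `U`, is dominated by the `U`-admissible blowing up `b : S' → X` of an
   ideal `𝓘` with `V(𝓘) = X ∖ U`, through the blowing up `r : S' → X'` of `𝓙 = π⁻¹𝓘 𝒪_{X'}`;
3. `CossartPiltant2019Principalization` (`Principalization.lean`; CP 2019 Prop. 4.4 [v1: 4.3]):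
   on the regular excellent threefold `X'` the non-zero `𝓙` is principalized by a sequence
   `σ : S'' → X'` of blowing ups in regular centres lying over `V(𝓙) = π⁻¹(X ∖ U)`.

Then `S''` is regular (`IsRegularCentreBlowupSeq.isRegular`), `σ` is ONE blowing up of `X'` in
some `𝓚` with `Supp 𝓚 ⊆ V(𝓙)` (Stacks 080B, `IsRegularCentreBlowupSeq.exists_isBlowup_supported`)
and, `𝓙𝒪_{S''}` being invertible, also the blowing up of `X'` in `𝓚 · 𝓙` (Stacks 080A); so is
`t ≫ r` for the blowing up `t : T → S'` of `r⁻¹𝓚 𝒪_{S'}` (080A again), whence `T ≅ S''` is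
regular and `t ≫ b : T → X` is one blowing up of `X = Spec A` in an ideal sheaf supported in
`X ∖ U` (080B), i.e. `T ≅ Bl_J(Spec A)` for an ideal `J ≠ 0` with `Bl_J → Spec A` an
isomorphism over `U` (`exists_affineBlowup_of_isBlowup_of_isRegular`). No projectivity /
ampleness theory is needed: the blow-up calculus of `Blowups*.lean` replaces Liu 8.1.24.

* `IsLocallyPrincipal.isEffectiveCartier_of_ne_bot`, `IsRegularCentreBlowupSeq.exists_isBlowup_supported`,
  `topologicalKrullDim_eq_of_isIso_morphismRestrict`, `affineBlowup.exists_eq_idealSheaf'`,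
  `exists_affineBlowup_of_isBlowup_of_isRegular` — the glue [folklore / Stacks 080B];
* `exists_affineBlowup_regular_of_ringKrullDim_eq_three` — **MAIN: the `J`-datum of
  `CossartPiltant2019AffineOneBlowup` for `dim A = 3` from the three named facts.**

The cases `dim A ≤ 2` of the fact are NOT covered here (`CossartPiltant2019Principalization` is
stated for threefolds only); they follow from Cossart–Jannsen–Saito's embedded resolution of
surfaces and are treated separately.

## References

* V. Cossart, O. Piltant, *Resolution of singularities of arithmetical threefolds*, J. Algebra 529
  (2019) 268–535 = arXiv:1412.0868: Thm. 1.1 and the sentence following (iii) (v1 p. 3);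
  Prop. 4.4 (v1: 4.3); proof of Prop. 4.6 (v1: 4.4), Step 3 (v1 p. 51). [CossartPiltant2019]
* M. Raynaud, L. Gruson, *Critères de platitude et de projectivité*, Invent. Math. 13 (1971),
  Première partie, 5.2.2. [RaynaudGruson1971]
* The Stacks Project, Tags 081T, 080A, 080B. [StacksProject]
* U. Görtz, T. Wedhorn, *Algebraic Geometry I*, 2nd ed. (2020), Thm. 5.22 (3), Def. 13.90.
  [GortzWedhorn2020]
-/

noncomputable section

open CategoryTheory CategoryTheory.Limits AlgebraicGeometry TopologicalSpace

namespace Literature.AlgebraicGeometry.Resolution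

universe u

open Scheme.IdealSheafData

/-! ## Auxiliary lemmas -/

/-- **A non-zero locally principal ideal sheaf on an integral scheme is an effective Cartier
divisor**: a local generator on an affine open of an integral scheme is a non-zero-divisor as soon
as it is non-zero, and it is non-zero because the generic point is off the support of a non-zero
ideal sheaf. [folklore] -/
theorem IsLocallyPrincipal.isEffectiveCartier_of_ne_bot {X : Scheme.{u}} [IsIntegral X]
    {J : X.IdealSheafData} (hJ : IsLocallyPrincipal J) (hJ0 : J ≠ ⊥) : IsEffectiveCartier J := by
  intro x
  obtain ⟨U, hxU, f, hf⟩ := hJ x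
  refine ⟨U, hxU, f, ?_, hf⟩
  haveI : Nonempty (U : X.Opens) := ⟨⟨x, hxU⟩⟩
  refine mem_nonZeroDivisors_of_ne_zero ?_
  rintro rfl
  have hη : genericPoint X ∈ (U : X.Opens) :=
    ((genericPoint_spec X).mem_open_set_iff U.1.isOpen).mpr ⟨x, Set.mem_univ _, hxU⟩
  refine not_mem_support_genericPoint hJ0 ?_
  rw [mem_support_iff_of_mem (I := J) (U := U) hη, Scheme.mem_zeroLocus_iff]
  intro g hg
  have hg0 : g = 0 := by
    rw [hf, SetLike.mem_coe, Ideal.span_singleton_eq_bot.mpr rfl] at hg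
    exact (Submodule.mem_bot _).mp hg
  subst hg0
  rw [Scheme.basicOpen_zero]
  exact fun h => h

/-- **A Cossart–Piltant sequence of blowing ups along regular centres is one blowing up**
supported in the support of the ideal sheaf being principalized (Noetherian base; Stacks 080B,
`IsBlowup.exists_isBlowup_comp_supported`, iterated: each centre lies in the non-locally-principal
locus of the transform `J𝒪`, hence in its support, the preimage of `Supp J`).
[cite: StacksProject, Tag 080B] -/
theorem IsRegularCentreBlowupSeq.exists_isBlowup_supported :
    ∀ {S' S : Scheme.{u}} {σ : S' ⟶ S} {J : S.IdealSheafData}, IsRegularCentreBlowupSeq σ J →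
      IsNoetherian S →
        ∃ K : S.IdealSheafData, IsBlowup σ K ∧ (K.support : Set S) ⊆ J.support := by
  intro S' S σ J h
  induction h with
  | nil J => exact fun _ => ⟨⊤, isBlowup_id_top _, by simp⟩
  | @cons S'' S' S τ σ J Y hσ hYint hYreg hY hτ ih =>
    intro hN
    haveI := hN
    obtain ⟨K, hK, hKJ⟩ := ih hN
    refine IsBlowup.exists_isBlowup_comp_supported σ K τ (vanishingIdeal Y)
      (J.support : Set S) hK hKJ hτ ?_
    intro y hy
    rw [coe_support_vanishingIdeal] at hy
    have h2 : y ∈ (J.comap σ).support := nonPrincipalLocus_le_support _ (hY y hy)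
    rw [support_comap] at h2
    exact h2

/-- **Birational schemes of finite type over a field have the same dimension**: if
`π : X' → X` (both integral, `X` locally of finite type over `k`, `π` locally of finite type) is
an isomorphism over a non-empty open `U ⊆ X`, then `dim X' = dim X` — both equal the dimension
of the common non-empty open `π⁻¹(U) ≅ U` (Görtz–Wedhorn I, Thm. 5.22 (3)).
[cite: GortzWedhorn2020, Thm. 5.22 (3)] -/
theorem topologicalKrullDim_eq_of_isIso_morphismRestrict {k : Type u} [Field k]
    {X' X : Scheme.{u}} [IsIntegral X] [IsIntegral X'] (f : X ⟶ Spec (.of k))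
    [LocallyOfFiniteType f] (π : X' ⟶ X) [LocallyOfFiniteType π] (U : X.Opens)
    (hU : (U : Set X).Nonempty) [IsIso (π ∣_ U)] :
    topologicalKrullDim X' = topologicalKrullDim X := by
  have hU' : ((π ⁻¹ᵁ U : X'.Opens) : Set X').Nonempty := by
    obtain ⟨x, hx⟩ := hU
    obtain ⟨x', hx'⟩ := (ConcreteCategory.bijective_of_isIso (π ∣_ U).base).2 ⟨x, hx⟩
    exact ⟨x'.1, x'.2⟩
  rw [← topologicalKrullDim_opens_eq (π ≫ f) (π ⁻¹ᵁ U) hU', ← topologicalKrullDim_opens_eq f U hU]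
  exact IsHomeomorph.topologicalKrullDim_eq _
    (Scheme.homeoOfIso (asIso (π ∣_ U))).isHomeomorph

/-- Every ideal sheaf on `Spec R` is the ideal sheaf of an ideal of `R`. [folklore] -/
theorem affineBlowup.exists_eq_idealSheaf' {R : Type u} [CommRing R]
    (J : (Spec (CommRingCat.of R)).IdealSheafData) :
    ∃ I : Ideal R, J = affineBlowup.idealSheaf I := by
  refine ⟨(J.ideal ⟨⊤, isAffineOpen_top _⟩).comap (Scheme.ΓSpecIso (.of R)).inv.hom, ?_⟩
  have hsurj : Function.Surjective (Scheme.ΓSpecIso (.of R)).inv.hom :=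
    (Scheme.ΓSpecIso (.of R)).commRingCatIsoToRingEquiv.symm.surjective
  unfold affineBlowup.idealSheaf
  rw [Ideal.map_comap_of_surjective _ hsurj]
  exact (equivOfIsAffine.symm_apply_apply J).symm

/-- **From one blowing up of `Spec A` with regular source to the blow-up form.** If
`ρ : T → Spec A` is a blowing up along an ideal sheaf `𝓛` whose support misses the non-empty open
`U`, with `T` regular, then there is a non-zero ideal `J ⊆ A` with `Bl_J(Spec A)` regular and
`Bl_J(Spec A) → Spec A` an isomorphism over `U` (every ideal sheaf on `Spec A` comes from an
ideal `J`; blowing ups are unique up to isomorphism; a blowing up is an isomorphism off its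
centre). [folklore] -/
theorem exists_affineBlowup_of_isBlowup_of_isRegular {A : Type u} [CommRing A]
    {T : Scheme.{u}} {ρ : T ⟶ Spec (.of A)} {𝓛 : (Spec (.of A)).IdealSheafData}
    (hρ : IsBlowup ρ 𝓛) (hT : Scheme.IsRegular T) (U : (Spec (.of A)).Opens)
    (hUne : (U : Set (Spec (.of A))).Nonempty)
    (hsupp : (𝓛.support : Set (Spec (.of A))) ⊆ (U : Set (Spec (.of A)))ᶜ) :
    ∃ J : Ideal A, J ≠ ⊥ ∧ Scheme.IsRegular (affineBlowup J) ∧ IsIso (affineBlowup.π J ∣_ U) := by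
  obtain ⟨J, rfl⟩ := affineBlowup.exists_eq_idealSheaf' 𝓛
  have hBl : IsBlowup (affineBlowup.π J) (affineBlowup.idealSheaf J) := affineBlowup.isBlowup J
  obtain ⟨e, -, -⟩ := hρ.unique hBl
  refine ⟨J, ?_, hT.of_iso e.hom, hBl.isIso_morphismRestrict ?_⟩
  · rintro rfl
    obtain ⟨x, hx⟩ := hUne
    refine hsupp ?_ hx
    rw [affineBlowup.support_idealSheaf, Submodule.bot_coe, PrimeSpectrum.zeroLocus_singleton_zero]
    exact Set.mem_univ x
  · exact Set.disjoint_left.mpr fun x hx hx' => hsupp hx' hx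

/-! ## The threefold case -/

/-- **The blow-up form of Cossart–Piltant's Thm. 1.1 for affine threefolds, from Thm. 1.1 as
printed, Raynaud–Gruson flattening and Cossart–Piltant's principalization.** For a field `K`
and an integral affine `Spec A` of finite type over `K` with `dim A = 3` there is a non-zero
ideal `J ⊆ A` with `Bl_J(Spec A)` regular and `Bl_J(Spec A) → Spec A` an isomorphism over the
regular locus, GIVEN the named facts `CossartPiltant2019General` (CP 2019, Thm. 1.1 (i)(ii)),
`Stacks081R` (Raynaud–Gruson: flattening by one `U`-admissible blowing up) and
`CossartPiltant2019Principalization` (CP 2019, Prop. 4.4 [arXiv v1: 4.3]). Proof: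
Thm. 1.1 gives a proper resolution `π : X' → X = Spec A` which is an isomorphism over
`U = Reg X`; by Stacks 081T (`exists_isBlowup_dominating_of_stacks081R`) the `U`-admissible
blowing up `b : S' → X` of some `𝓘` with `V(𝓘) = X ∖ U` dominates `X'` through the blowing up
`r : S' → X'` of `𝓙 = π⁻¹𝓘 𝒪_{X'}`; principalization of `𝓙` on the regular excellent threefold
`X'` yields `σ : S'' → X'`, a sequence of blowing ups in regular centres — a single blowing up in
some `𝓚` supported in `V(𝓙)` (Stacks 080B) — with `S''` regular and `𝓙𝒪_{S''}` invertible,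
so that `σ` is also the blowing up of `X'` in `𝓚 · 𝓙` (Stacks 080A); so is the composite of `r`
with the blowing up `t : T → S'` of `r⁻¹𝓚 𝒪_{S'}`, whence `T ≅ S''` is regular and
`T → S' → X` is one blowing up of `X` in an ideal `J` supported in `X ∖ U` (Stacks 080B).
This is Cossart–Piltant's Step 3 ("achieving (i) with `π` projective for `𝒳 = Spec A` affine")
re-run on top of the conclusion of Thm. 1.1 instead of (LU).
[cite: CossartPiltant2019, Thm. 1.1 (i)(ii) and the sentence following (iii); Prop. 4.4]
[cite: StacksProject, Tag 081T; Tag 080A; Tag 080B] -/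
theorem exists_affineBlowup_regular_of_ringKrullDim_eq_three
    (hG : CossartPiltant2019General.{u}) (h081R : Stacks081R.{u})
    (hP : CossartPiltant2019Principalization.{u})
    (K : Type u) [Field K] (A : Type u) [CommRing A] [IsDomain A] [Algebra K A]
    [Algebra.FiniteType K A] (hdim : ringKrullDim A = 3) :
    ∃ J : Ideal A, J ≠ ⊥ ∧ Scheme.IsRegular (affineBlowup J) ∧
      ∃ U : (Spec (.of A)).Opens,
        (U : Set (Spec (.of A))) = {x | IsRegularLocalRing (Localization.AtPrime x.asIdeal)} ∧
          IsIso (affineBlowup.π J ∣_ U) := by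
  classical
  haveI : IsNoetherianRing A := Algebra.FiniteType.isNoetherianRing K A
  let X : Scheme.{u} := Spec (.of A)
  let f : X ⟶ Spec (.of K) := Spec.map (CommRingCat.ofHom (algebraMap K A))
  haveI : LocallyOfFiniteType f :=
    (HasRingHomProperty.Spec_iff (P := @LocallyOfFiniteType)).mpr
      (RingHom.finiteType_algebraMap.mpr inferInstance)
  have hqe : Scheme.IsQuasiExcellent X :=
    Scheme.isQuasiExcellent_of_locallyOfFiniteType Stacks07QW_field_holds f
  have hdimX : topologicalKrullDim X = 3 :=
    (PrimeSpectrum.topologicalKrullDim_eq_ringKrullDim (R := A)).trans hdim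
  haveI : IsIntegral X := inferInstanceAs (IsIntegral (Spec (.of A)))
  haveI : IsNoetherian X := inferInstanceAs (IsNoetherian (Spec (.of A)))
  -- (1) Cossart–Piltant Thm. 1.1 as printed
  obtain ⟨X', π, hπ, U, hU, hisoU⟩ := hG X hqe hdimX.le
  haveI := hisoU
  haveI : IsProper π := hπ.isProper
  haveI : IsReduced X' := hπ.isRegular.isReduced
  haveI : IsIntegral X' := hπ.isBirational.isIntegral
  haveI : IsNoetherian X' := by
    haveI : IsLocallyNoetherian X' := LocallyOfFiniteType.isLocallyNoetherian π
    haveI : CompactSpace X' := QuasiCompact.compactSpace_of_compactSpace π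
    exact {}
  -- `U = Reg X` is non-empty: the generic point is regular (its local ring is the function field)
  have hUne : (U : Set X).Nonempty := by
    refine ⟨genericPoint X, ?_⟩
    rw [hU, Scheme.mem_regularLocus]
    exact inferInstanceAs (IsRegularLocalRing X.functionField)
  -- (2) Stacks 081T: the `U`-admissible blowing up dominating `X'`
  obtain ⟨I, S', b, r, -, hIsupp, hb, hrπ, hr⟩ :=
    exists_isBlowup_dominating_of_stacks081R h081R π U (NoetherianSpace.isCompact _)
  -- `𝓙 = π⁻¹𝓘 𝒪_{X'}` is non-zero: `π⁻¹(U) ≅ U` is non-empty and off `V(𝓙) = π⁻¹ V(𝓘)`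
  have h𝓙 : I.comap π ≠ ⊥ := by
    intro h0
    obtain ⟨x, hx⟩ := hUne
    obtain ⟨x', hx'⟩ := (ConcreteCategory.bijective_of_isIso (π ∣_ U).base).2 ⟨x, hx⟩
    have hmem : x'.1 ∈ (I.comap π).support := by rw [h0, support_bot]; trivial
    rw [support_comap] at hmem
    have hmem' : π x'.1 ∈ (I.support : Set X) := hmem
    rw [hIsupp] at hmem'
    exact hmem' x'.2
  -- (3) principalization of `𝓙` on the regular excellent threefold `X'`
  have hexc : Scheme.IsExcellent X' :=
    Scheme.isExcellent_of_locallyOfFiniteType Stacks07QW_field_holds (π ≫ f)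
  have hdimX' : topologicalKrullDim X' = 3 :=
    (topologicalKrullDim_eq_of_isIso_morphismRestrict f π U hUne).trans hdimX
  obtain ⟨S'', σ, hseq, hprinc⟩ := hP X' hπ.isRegular hexc hdimX' (I.comap π) h𝓙
  haveI : IsIntegral S'' := hseq.isIntegral h𝓙
  have hS''reg : Scheme.IsRegular S'' := hseq.isRegular hπ.isRegular
  have hcart : IsEffectiveCartier ((I.comap π).comap σ) :=
    hprinc.isEffectiveCartier_of_ne_bot
      (hseq.isIntegral_and_comap_ne_bot inferInstance inferInstance h𝓙).2.2
  -- `σ` is one blowing up in `𝓚`, `Supp 𝓚 ⊆ V(𝓙)`, and also the blowing up in `𝓚 · 𝓙`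
  obtain ⟨𝓚, h𝓚, h𝓚supp⟩ := hseq.exists_isBlowup_supported inferInstance
  have hσ : IsBlowup σ (𝓚 * I.comap π) := by
    have := h𝓚.comp (IsBlowup.id hcart)
    rwa [Category.id_comp] at this
  -- the blowing up `t : T → S'` of `r⁻¹𝓚`; `t ≫ r` is the blowing up of `X'` in `𝓙 · 𝓚`
  obtain ⟨T, t, ht⟩ := exists_isBlowup S' (𝓚.comap r)
  have htr : IsBlowup (t ≫ r) (𝓚 * I.comap π) := by
    rw [mul_comm]
    exact hr.comp ht
  obtain ⟨e, -, -⟩ := hσ.unique htr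
  have hTreg : Scheme.IsRegular T := hS''reg.of_iso e.hom
  -- `t ≫ b : T → X` is one blowing up of `X` in an ideal sheaf supported in `X ∖ U`
  have h𝓚r : ((𝓚.comap r).support : Set S') ⊆ b ⁻¹' (U : Set X)ᶜ := by
    intro s hs
    rw [support_comap] at hs
    have hs' : r s ∈ ((I.comap π).support : Set X') := h𝓚supp hs
    rw [support_comap] at hs'
    have hs'' : π (r s) ∈ (I.support : Set X) := hs'
    rw [hIsupp, ← Scheme.Hom.comp_apply, hrπ] at hs''
    exact hs''
  obtain ⟨𝓛, h𝓛, h𝓛supp⟩ :=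
    IsBlowup.exists_isBlowup_comp_supported b I t (𝓚.comap r) ((U : Set X)ᶜ) hb hIsupp.le ht h𝓚r
  -- read off the blow-up form
  obtain ⟨J, hJ, hreg, hiso⟩ :=
    exists_affineBlowup_of_isBlowup_of_isRegular h𝓛 hTreg U hUne h𝓛supp
  exact ⟨J, hJ, hreg, U, hU.trans (regularLocus_Spec_eq A), hiso⟩

end Literature.AlgebraicGeometry.Resolution

end
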